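import Summits.CriticalPhenomena.PercolationContinuityZ3.Theorems.PercNearOneGluingNoHeavyLowerTailSahiCombTriWGeneral

/-!
# The five-up-set inequality, RANK route V: the rank theorem for every ANTIPODAL CLASS PAIR of `TRI_W(a)` ('RANK-Z_x')

Support file of the one-cut programme (crux `NoHeavyLowerTail`, stmt-CriticalPhenomena-4575; cell `prim-masterthm` seat P5, gen 10;
report `P5-LORENTZIAN-TEST.md` §15.14–15.15, memo `FROM-prim-masterthm-p5-g10-TWO-COPY-STRUCTURE.md` §9).

Setting of `FiveUpSet.triW` (`…SahiCombTriWGeneral`): a cube `W = Finset α`, monotone families `F, G : Finset β → up-sets of W` indexed by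
the small cube `X = Finset β` (antipode `x ↦ xᶜ`), fibres `U_y = F y ∩ G y`.  The census-validated two-copy certificate CERT-Z for
`TRI_W(a) ≥ 0` (report §15.14) is built from the CLASS PAIRS
  `𝒞_x = {d ∈ F x : dᶜ ∈ G xᶜ}` placed at level `x`  ⊔  `{d ∈ G x : dᶜ ∈ F xᶜ}` placed at level `xᶜ`,
whose levelled Ω-zeta rows are `(d, ℓ) ↦ ([ℓ ⊆ y]·[d ⊆ t])_{(y,t) : t ∈ U_y}`.  Step (Z1) of the proof plan is that EVERY class pair alone is
linearly independent.  This file proves it, for all `a` and all `x`: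

* **`rankZPair_kernel_eq_zero`** (`x ≠ ∅`): if `a` is supported on `{d ∈ F x : dᶜ ∈ G xᶜ}`, `b` on `{d ∈ G x : dᶜ ∈ F xᶜ}`, and for every
  `y` and `t ∈ U_y`, `[x ⊆ y]·Σ_d a_d [d ⊆ t] + [xᶜ ⊆ y]·Σ_d b_d [d ⊆ t] = 0`, then `a = b = 0`.  PROOF: it is an INSTANCE of prim-lf-1's
  `rankZ_kernel_eq_zero` (`…SahiCombFiveUpSetProof`) for the nested pairs `F xᶜ ⊆ F univ`, `G xᶜ ⊆ G univ` (the class pair is a sub-family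
  of RANK-Z's `S₁ ⊔ S₂`, the `S₃`-part being empty), using only the equations at the top fibre `y = univ` and at `y = xᶜ` (where the
  first class is invisible because `x ⊄ xᶜ`).  For `x = univ` this is RANK-Z itself without `S₃`.
* **`rankZPair_kernel_eq_zero_empty`** (`x = ∅`, the mirror pair `{d ∈ F ∅ : dᶜ ∈ G univ}@∅ ⊔ {d ∈ G ∅ : dᶜ ∈ F univ}@univ`): POINT supports
  (the first combination lives on `F ∅`, the second on `G ∅`), the fibre `U_∅`, and C1 (`eq_zero_of_zeta_sum_eq_zero`) twice.
Census behind the design (code10/exp_classpairs.py): (Z1) exhaustive at `(n,a) = (2,1), (2,2)` for every `x`; the JOINT statements (Z2)/(Z3)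
and the K-part of CERT-Z (report §15.14) are NOT proved here.
HONEST LABEL: two complete proofs (std axioms), one a direct corollary of `rankZ_kernel_eq_zero`; nothing here proves `TriWIneq`. [this work]
-/

namespace Summit.CriticalPhenomena.PercolationContinuityZ3.Theorems

namespace FiveUpSet

open Finset

variable {α β : Type} [DecidableEq α] [Fintype α] [DecidableEq β] [Fintype β]

/-- A nonempty finset is not contained in its complement. [this work] -/
theorem not_subset_compl_of_ne_empty {x : Finset β} (hx : x ≠ ∅) : ¬ x ⊆ xᶜ := by
  intro h
  obtain ⟨e, he⟩ := Finset.nonempty_iff_ne_empty.2 hx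
  have h' := h he
  rw [Finset.mem_compl] at h'
  exact h' he

/-- **(Z1) for `x ≠ ∅`: the antipodal class pair `𝒞_x` is linearly independent** (report §15.15 (i),(iii)).  `F, G` monotone families of
up-sets of the cube indexed by `Finset β`; `a` supported on `{d ∈ F x : dᶜ ∈ G xᶜ}` (level `x`), `b` on `{d ∈ G x : dᶜ ∈ F xᶜ}` (level `xᶜ`);
if for every `y` and every `t ∈ F y ∩ G y`, `[x ⊆ y]·Σ_d a_d [d ⊆ t] + [xᶜ ⊆ y]·Σ_d b_d [d ⊆ t] = 0`, then `a = 0` and `b = 0`.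
An instance of `rankZ_kernel_eq_zero` with `(A₀, A₁, B₀, B₁) = (F xᶜ, F univ, G xᶜ, G univ)`. [this work] -/
theorem rankZPair_kernel_eq_zero (F G : Finset β → Finset (Finset α))
    (hF : ∀ x, IsUpperSet (F x : Set (Finset α))) (hG : ∀ x, IsUpperSet (G x : Set (Finset α)))
    (hFm : Monotone F) (hGm : Monotone G) (x : Finset β) (hx : x ≠ ∅)
    (a b : Finset α → ℚ)
    (ha : ∀ d, a d ≠ 0 → d ∈ F x ∧ dᶜ ∈ G xᶜ)
    (hb : ∀ d, b d ≠ 0 → d ∈ G x ∧ dᶜ ∈ F xᶜ)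
    (h : ∀ y, ∀ t, t ∈ F y → t ∈ G y →
      (if x ⊆ y then ∑ d, a d * (if d ⊆ t then (1 : ℚ) else 0) else 0) +
        (if xᶜ ⊆ y then ∑ d, b d * (if d ⊆ t then (1 : ℚ) else 0) else 0) = 0) :
    (∀ d, a d = 0) ∧ (∀ d, b d = 0) := by
  have hxu : x ⊆ univ := subset_univ x
  have hxcu : xᶜ ⊆ univ := subset_univ xᶜ
  refine rankZ_kernel_eq_zero (F xᶜ) (F univ) (G xᶜ) (G univ) (hF xᶜ) (hF univ) (hG xᶜ) (hG univ)
    (hFm hxcu) (hGm hxcu) a b ?_ ?_ ?_ ?_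
  · intro d hd
    exact ⟨hFm hxu (ha d hd).1, (ha d hd).2⟩
  · intro d hd
    exact Or.inl ⟨(hb d hd).2, hGm hxu (hb d hd).1⟩
  · intro t ht1 ht2
    have e := h univ t ht1 ht2
    rwa [if_pos hxu, if_pos hxcu] at e
  · intro t ht1 ht2
    have e := h xᶜ t ht1 ht2
    rwa [if_neg (not_subset_compl_of_ne_empty hx), if_pos (Subset.refl _), zero_add] at e

omit [DecidableEq β] in
/-- **(Z1) for `x = ∅`: the mirror class pair is linearly independent** (report §15.15 (ii)).  `a` supported on `{d ∈ F ∅ : dᶜ ∈ G univ}`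
(level `∅`, visible at every fibre), `b` on `{d ∈ G ∅ : dᶜ ∈ F univ}` (level `univ`, visible at the top fibre only); if
`Σ_d a_d [d ⊆ t] + Σ_d b_d [d ⊆ t] = 0` for `t ∈ F univ ∩ G univ` and `Σ_d a_d [d ⊆ t] = 0` for `t ∈ F ∅ ∩ G ∅`, then `a = b = 0`.
Proof by POINT supports: the `a`-combination vanishes off `F ∅`, the `b`-combination off `G ∅`, so on the top fibre both vanish pointwise
(on `F ∅ ∩ G ∅` by the second hypothesis); then C1 on `G univ` and on `F univ`. [this work] -/
theorem rankZPair_kernel_eq_zero_empty (F G : Finset β → Finset (Finset α))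
    (hF : ∀ x, IsUpperSet (F x : Set (Finset α))) (hG : ∀ x, IsUpperSet (G x : Set (Finset α)))
    (hFm : Monotone F) (hGm : Monotone G)
    (a b : Finset α → ℚ)
    (ha : ∀ d, a d ≠ 0 → d ∈ F ∅ ∧ dᶜ ∈ G univ)
    (hb : ∀ d, b d ≠ 0 → d ∈ G ∅ ∧ dᶜ ∈ F univ)
    (h1 : ∀ t, t ∈ F univ → t ∈ G univ →
      ∑ d, a d * (if d ⊆ t then (1 : ℚ) else 0) + ∑ d, b d * (if d ⊆ t then (1 : ℚ) else 0) = 0)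
    (h0 : ∀ t, t ∈ F ∅ → t ∈ G ∅ → ∑ d, a d * (if d ⊆ t then (1 : ℚ) else 0) = 0) :
    (∀ d, a d = 0) ∧ (∀ d, b d = 0) := by
  have h0u : (∅ : Finset β) ⊆ univ := subset_univ ∅
  -- the two combinations vanish off `F ∅` resp. off `G ∅`
  have hAoff : ∀ t, t ∉ F ∅ → ∑ d, a d * (if d ⊆ t then (1 : ℚ) else 0) = 0 := by
    intro t ht
    refine Finset.sum_eq_zero fun d _ => ?_
    by_cases hd : a d = 0
    · rw [hd, zero_mul]
    · have hdt : ¬ d ⊆ t := fun h' => ht (hF ∅ h' (ha d hd).1)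
      rw [if_neg hdt, mul_zero]
  have hBoff : ∀ t, t ∉ G ∅ → ∑ d, b d * (if d ⊆ t then (1 : ℚ) else 0) = 0 := by
    intro t ht
    refine Finset.sum_eq_zero fun d _ => ?_
    by_cases hd : b d = 0
    · rw [hd, zero_mul]
    · have hdt : ¬ d ⊆ t := fun h' => ht (hG ∅ h' (hb d hd).1)
      rw [if_neg hdt, mul_zero]
  -- on the top fibre both combinations vanish pointwise
  have hAtop : ∀ t, t ∈ F univ → t ∈ G univ → ∑ d, a d * (if d ⊆ t then (1 : ℚ) else 0) = 0 := by
    intro t ht1 ht2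
    by_cases htF : t ∈ F ∅
    · by_cases htG : t ∈ G ∅
      · exact h0 t htF htG
      · have e := h1 t ht1 ht2
        rwa [hBoff t htG, add_zero] at e
    · exact hAoff t htF
  have hBtop : ∀ t, t ∈ F univ → t ∈ G univ → ∑ d, b d * (if d ⊆ t then (1 : ℚ) else 0) = 0 := by
    intro t ht1 ht2
    have e := h1 t ht1 ht2
    rwa [hAtop t ht1 ht2, zero_add] at e
  -- C1 on `G univ` (the `a`-sets have complements there) and on `F univ`
  have hazero : ∀ d, a d = 0 := by
    refine eq_zero_of_zeta_sum_eq_zero (hG univ) a (fun d hd => (ha d hd).2) ?_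
    intro t htG
    by_cases htF : t ∈ F univ
    · exact hAtop t htF htG
    · refine hAoff t fun h' => htF (hFm h0u h')
  have hbzero : ∀ d, b d = 0 := by
    refine eq_zero_of_zeta_sum_eq_zero (hF univ) b (fun d hd => (hb d hd).2) ?_
    intro t htF
    by_cases htG : t ∈ G univ
    · exact hBtop t htF htG
    · refine hBoff t fun h' => htG (hGm h0u h')
  exact ⟨hazero, hbzero⟩

end FiveUpSet

end Summit.CriticalPhenomena.PercolationContinuityZ3.Theorems
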